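import Mathlib
import HarnessLib
import Summits.RiemannHypothesis.Statement
import Summits.RiemannHypothesis.RiemannHypothesis.Theorems.SuzukiWindowsDoorConverseRH
import Summits.RiemannHypothesis.RiemannHypothesis.Theorems.DeBrangesSuzukiDoorDoorModuloKernel
import Literature.NumberTheory.LFunctions.SuzukiSingleOperatorKernelProofs
import Summits.RiemannHypothesis.RiemannHypothesis.Theorems.DeBrangesSuzukiDoorEveryWitnessFactorisation

/-!
# RiemannHypothesis / de Branges–Suzuki door — EVERY non-zero `f ∈ L²(−1,1)` is a door witness, file 2/2:
**P1b** window-symbol non-vanishing (ζ-FREE) and the assembled theorem `rh_of_windowWitness` (RH-FREE; zero definitions)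

Cell rh-split, seat dbr/finite gen 2 (`SketchG2.lean` sha16 1447610eece51980), RAW-ified and filed by rh-split-typer-2 g2.
P1b (`windowSymbolNonvanishing`): if `F♯_f` vanished on `ℂ₊`, all exponential moments `∫_{(−1,1)} f(y) e^{sy} dy` (`s > 0`)
vanish (`expMoment_eq_zero_of_windowSymbol`); Stone–Weierstrass on `C([−1,1])` with the exponentials `y ↦ e^{sy}`, `s ≥ 0`
(they separate points; the generated subalgebra is dense), the weight `e^{y}`, the functional
`g ↦ ∫_{(−1,1)} e^{y} g̃(y) f(y) dy` (`g̃ = IccExtend`) bounded by `e‖g‖‖f‖₁`, and the distributional lemma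
`IsOpen.ae_eq_zero_of_integral_contDiff_smul_eq_zero` force `f = 0` a.e.  Main results:
* `everyWitnessDetectsRH (hθ : 10 < θ)` — P1 for `θ > 10`;
* `rh_of_windowWitness` — **for `θ > 10`, every `f ∈ L²(−1,1)` not a.e. zero whose window image
  `x ↦ ∫_{(−1,1)} K_θ(x+y) f(y) dy` is in `L²(ℝ)` proves RH** (standard axioms).
RH-FREE implications about an RH-EQUIVALENT criterion; SPLITTING SEARCH bookkeeping; nothing in this file bears on the truth of RH.
-/

noncomputable section

set_option linter.dupNamespace false

namespace Summit.RiemannHypothesis.RiemannHypothesis.Theorems.SuzukiDoorEveryWitness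

open MeasureTheory Set Complex Filter
open scoped Topology
open Literature.NumberTheory.LFunctions (NoUnitEigenvalue limKernel limTheta Suzuki2020_thm12_continuous
  Suzuki2020_thm12_Kiii)

/-! ## P1b PROVED (ζ-free): the window symbol of a nonzero `f ∈ L²(−1,1)` does not vanish on `ℂ₊`
Stone–Weierstrass on `C([−1,1])` with the exponentials `y ↦ e^{sy}` (`s ≥ 0`), the weight `e^{y}`, and the distributional
lemma `IsOpen.ae_eq_zero_of_integral_contDiff_smul_eq_zero`. -/

/-- Step 1: along the imaginary axis the symbol is a real exponential moment. -/
theorem expMoment_eq_zero_of_windowSymbol {f : ℝ → ℝ}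
    (h0 : ∀ z : ℂ, 0 < z.im → (∫ u : ℝ, (((Ioo (-1 : ℝ) 1).indicator (fun u => f (-u)) u : ℝ) : ℂ) * Complex.exp (I * z * (u : ℂ))) = 0) {s : ℝ} (hs : 0 < s) :
    ∫ y in Ioo (-1 : ℝ) 1, f y * Real.exp (s * y) = 0 := by
  have h := h0 ((s : ℂ) * I) (by simpa using hs)
  rw [windowSymbol_eq_setIntegral] at h
  have hI : -(I * ((s : ℂ) * I)) = (s : ℂ) := by
    rw [mul_comm (s : ℂ) I, ← mul_assoc, Complex.I_mul_I]; ring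
  have h' : ∫ y in Ioo (-1 : ℝ) 1, (f y : ℂ) * Complex.exp (-(I * ((s : ℂ) * I)) * (y : ℂ))
      = ((∫ y in Ioo (-1 : ℝ) 1, f y * Real.exp (s * y) : ℝ) : ℂ) := by
    rw [← integral_complex_ofReal]
    congr 1
    funext y
    rw [hI]
    push_cast
    rfl
  rw [h'] at h
  exact_mod_cast h

/-- `−1 ≤ 1`. -/
theorem h11 : (-1 : ℝ) ≤ 1 := by norm_num

/-- The unital subalgebra of `C([−1,1], ℝ)` generated by the exponentials `x ↦ e^{sx}`, `s ≥ 0`, separates points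
(`e^{x}` is injective). -/
theorem expAlg_separatesPoints : (Algebra.adjoin ℝ {g : C(Icc (-1 : ℝ) 1, ℝ) | ∃ s : ℝ, 0 ≤ s ∧ g = (⟨fun x : Icc (-1 : ℝ) 1 => Real.exp (s * (x : ℝ)), by fun_prop⟩ : C(Icc (-1 : ℝ) 1, ℝ))}).SeparatesPoints := by
  intro x y hxy
  refine ⟨(⟨fun x : Icc (-1 : ℝ) 1 => Real.exp (1 * (x : ℝ)), by fun_prop⟩ : C(Icc (-1 : ℝ) 1, ℝ)), ⟨(⟨fun x : Icc (-1 : ℝ) 1 => Real.exp (1 * (x : ℝ)), by fun_prop⟩ : C(Icc (-1 : ℝ) 1, ℝ)), Algebra.subset_adjoin ⟨1, zero_le_one, rfl⟩, rfl⟩, ?_⟩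
  simp only [ContinuousMap.coe_mk, one_mul]
  exact fun h => hxy (Subtype.ext (Real.exp_injective h))

/-- The integrand `e^{y} g̃(y) f(y)` of the test functional `Λ_f(g) = ∫_{(−1,1)} e^{y} g̃(y) f(y) dy` (`g̃ = IccExtend g`)
is integrable for `f ∈ L¹(−1,1)`. -/
theorem lam_integrable {f : ℝ → ℝ} (hfi : Integrable f (volume.restrict (Ioo (-1 : ℝ) 1)))
    (g : C(Icc (-1 : ℝ) 1, ℝ)) :
    Integrable (fun y => (Real.exp y * IccExtend h11 g y) * f y) (volume.restrict (Ioo (-1 : ℝ) 1)) := by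
  refine hfi.bdd_mul (c := Real.exp 1 * ‖g‖) ?_ ?_
  · exact (Real.continuous_exp.mul (g.continuous.Icc_extend' (h := h11))).aestronglyMeasurable
  · rw [ae_restrict_iff' measurableSet_Ioo]
    refine ae_of_all _ fun y hy => ?_
    rw [norm_mul, Real.norm_eq_abs, Real.abs_exp]
    have h1 : Real.exp y ≤ Real.exp 1 := Real.exp_le_exp.mpr hy.2.le
    have h2 : ‖IccExtend h11 g y‖ ≤ ‖g‖ := g.norm_coe_le_norm (Set.projIcc (-1) 1 h11 y)
    exact mul_le_mul h1 h2 (norm_nonneg _) (Real.exp_pos 1).le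

/-- Operator bound `|Λ_f(g)| ≤ e · ‖g‖ · ‖f‖₁`. -/
theorem abs_lam_le {f : ℝ → ℝ} (hfi : Integrable f (volume.restrict (Ioo (-1 : ℝ) 1))) (g : C(Icc (-1 : ℝ) 1, ℝ)) :
    |(∫ y in Ioo (-1 : ℝ) 1, (Real.exp y * IccExtend h11 g y) * f y)| ≤ Real.exp 1 * ‖g‖ * ∫ y in Ioo (-1 : ℝ) 1, |f y| := by
  rw [← Real.norm_eq_abs]
  calc ‖∫ y in Ioo (-1 : ℝ) 1, (Real.exp y * IccExtend h11 g y) * f y‖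
      ≤ ∫ y in Ioo (-1 : ℝ) 1, ‖(Real.exp y * IccExtend h11 g y) * f y‖ := norm_integral_le_integral_norm _
    _ ≤ ∫ y in Ioo (-1 : ℝ) 1, Real.exp 1 * ‖g‖ * |f y| := by
        refine integral_mono_ae (lam_integrable hfi g).norm (hfi.abs.const_mul _) ?_
        rw [EventuallyLE, ae_restrict_iff' measurableSet_Ioo]
        refine ae_of_all _ fun y hy => ?_
        rw [norm_mul, norm_mul, Real.norm_eq_abs, Real.norm_eq_abs (f y), Real.abs_exp]
        have h1 : Real.exp y ≤ Real.exp 1 := Real.exp_le_exp.mpr hy.2.le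
        have h2 : ‖IccExtend h11 g y‖ ≤ ‖g‖ := g.norm_coe_le_norm (Set.projIcc (-1) 1 h11 y)
        have h3 : Real.exp y * ‖IccExtend h11 g y‖ ≤ Real.exp 1 * ‖g‖ :=
          mul_le_mul h1 h2 (norm_nonneg _) (Real.exp_pos 1).le
        exact mul_le_mul_of_nonneg_right h3 (abs_nonneg _)
    _ = Real.exp 1 * ‖g‖ * ∫ y in Ioo (-1 : ℝ) 1, |f y| := integral_const_mul _ _

/-- `Λ_f` is additive. -/
theorem lam_add {f : ℝ → ℝ} (hfi : Integrable f (volume.restrict (Ioo (-1 : ℝ) 1))) (g₁ g₂ : C(Icc (-1 : ℝ) 1, ℝ)) :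
    (∫ y in Ioo (-1 : ℝ) 1, (Real.exp y * IccExtend h11 (g₁ + g₂) y) * f y) = (∫ y in Ioo (-1 : ℝ) 1, (Real.exp y * IccExtend h11 g₁ y) * f y) + (∫ y in Ioo (-1 : ℝ) 1, (Real.exp y * IccExtend h11 g₂ y) * f y) := by
  rw [← integral_add (lam_integrable hfi g₁) (lam_integrable hfi g₂)]
  congr 1
  funext y
  simp only [Set.IccExtend, Function.comp_apply, ContinuousMap.add_apply]
  ring

/-- `Λ_f` respects subtraction. -/
theorem lam_sub {f : ℝ → ℝ} (hfi : Integrable f (volume.restrict (Ioo (-1 : ℝ) 1))) (g₁ g₂ : C(Icc (-1 : ℝ) 1, ℝ)) :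
    (∫ y in Ioo (-1 : ℝ) 1, (Real.exp y * IccExtend h11 (g₁ - g₂) y) * f y) = (∫ y in Ioo (-1 : ℝ) 1, (Real.exp y * IccExtend h11 g₁ y) * f y) - (∫ y in Ioo (-1 : ℝ) 1, (Real.exp y * IccExtend h11 g₂ y) * f y) := by
  rw [← integral_sub (lam_integrable hfi g₁) (lam_integrable hfi g₂)]
  congr 1
  funext y
  simp only [Set.IccExtend, Function.comp_apply, ContinuousMap.sub_apply]
  ring

/-- `Λ_f` is homogeneous. -/
theorem lam_smul (f : ℝ → ℝ) (c : ℝ) (g : C(Icc (-1 : ℝ) 1, ℝ)) : (∫ y in Ioo (-1 : ℝ) 1, (Real.exp y * IccExtend h11 (c • g) y) * f y) = c * (∫ y in Ioo (-1 : ℝ) 1, (Real.exp y * IccExtend h11 g y) * f y) := by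
  rw [← integral_const_mul]
  congr 1
  funext y
  simp only [Set.IccExtend, Function.comp_apply, ContinuousMap.smul_apply, smul_eq_mul]
  ring

/-- `Λ_f(0) = 0`. -/
theorem lam_zero (f : ℝ → ℝ) : (∫ y in Ioo (-1 : ℝ) 1, (Real.exp y * IccExtend h11 0 y) * f y) = 0 := by
  simp [Set.IccExtend, Function.comp_apply]

/-- Elements of the monoid generated by the exponentials are exponentials. -/
theorem exists_eq_expCM_of_mem_closure {g : C(Icc (-1 : ℝ) 1, ℝ)}
    (hg : g ∈ Submonoid.closure {g : C(Icc (-1 : ℝ) 1, ℝ) | ∃ s : ℝ, 0 ≤ s ∧ g = (⟨fun x : Icc (-1 : ℝ) 1 => Real.exp (s * (x : ℝ)), by fun_prop⟩ : C(Icc (-1 : ℝ) 1, ℝ))}) :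
    ∃ s : ℝ, 0 ≤ s ∧ g = (⟨fun x : Icc (-1 : ℝ) 1 => Real.exp (s * (x : ℝ)), by fun_prop⟩ : C(Icc (-1 : ℝ) 1, ℝ)) := by
  refine Submonoid.closure_induction (motive := fun g _ => ∃ s : ℝ, 0 ≤ s ∧ g = (⟨fun x : Icc (-1 : ℝ) 1 => Real.exp (s * (x : ℝ)), by fun_prop⟩ : C(Icc (-1 : ℝ) 1, ℝ))) ?_ ?_ ?_ hg
  · rintro _ ⟨s, hs, rfl⟩; exact ⟨s, hs, rfl⟩
  · exact ⟨0, le_rfl, by ext x; simp⟩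
  · rintro _ _ _ _ ⟨s, hs, rfl⟩ ⟨t, ht, rfl⟩
    refine ⟨s + t, add_nonneg hs ht, ?_⟩
    ext x
    simp only [ContinuousMap.mul_apply, ContinuousMap.coe_mk, ← Real.exp_add]
    ring_nf

/-- `Λ_f` vanishes on the exponential algebra when all exponential moments of `f` vanish. -/
theorem lam_eq_zero_of_mem_expAlg {f : ℝ → ℝ} (hfi : Integrable f (volume.restrict (Ioo (-1 : ℝ) 1)))
    (h0 : ∀ s : ℝ, 0 < s → ∫ y in Ioo (-1 : ℝ) 1, f y * Real.exp (s * y) = 0)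
    {g : C(Icc (-1 : ℝ) 1, ℝ)} (hg : g ∈ (Algebra.adjoin ℝ {g : C(Icc (-1 : ℝ) 1, ℝ) | ∃ s : ℝ, 0 ≤ s ∧ g = (⟨fun x : Icc (-1 : ℝ) 1 => Real.exp (s * (x : ℝ)), by fun_prop⟩ : C(Icc (-1 : ℝ) 1, ℝ))})) : (∫ y in Ioo (-1 : ℝ) 1, (Real.exp y * IccExtend h11 g y) * f y) = 0 := by
  have hg' : g ∈ Subalgebra.toSubmodule (Algebra.adjoin ℝ {g : C(Icc (-1 : ℝ) 1, ℝ) | ∃ s : ℝ, 0 ≤ s ∧ g = (⟨fun x : Icc (-1 : ℝ) 1 => Real.exp (s * (x : ℝ)), by fun_prop⟩ : C(Icc (-1 : ℝ) 1, ℝ))}) := hg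
  rw [Algebra.adjoin_eq_span] at hg'
  refine Submodule.span_induction
    (p := fun (g : C(Icc (-1 : ℝ) 1, ℝ)) _ => (∫ y in Ioo (-1 : ℝ) 1, (Real.exp y * IccExtend h11 g y) * f y) = 0) ?_ ?_ ?_ ?_ hg'
  · intro g hg
    obtain ⟨s, hs, rfl⟩ := exists_eq_expCM_of_mem_closure hg
    rw [setIntegral_congr_fun measurableSet_Ioo (g := fun y => f y * Real.exp ((1 + s) * y)) ?_]
    · exact h0 (1 + s) (by linarith)
    · intro y hy
      have hyI : y ∈ Icc (-1 : ℝ) 1 := Ioo_subset_Icc_self hy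
      simp only [Set.IccExtend_of_mem h11 _ hyI, ContinuousMap.coe_mk]
      rw [show (1 + s) * y = y + s * y by ring, Real.exp_add]
      ring
  · exact lam_zero f
  · intro g₁ g₂ _ _ h1 h2
    rw [lam_add hfi, h1, h2, add_zero]
  · intro c g _ h
    rw [lam_smul, h, mul_zero]

/-- `Λ_f ≡ 0` on `C([−1,1])` (Stone–Weierstrass + the operator bound `|Λ_f g| ≤ e‖g‖‖f‖₁`). -/
theorem lam_eq_zero {f : ℝ → ℝ} (hfi : Integrable f (volume.restrict (Ioo (-1 : ℝ) 1)))
    (h0 : ∀ s : ℝ, 0 < s → ∫ y in Ioo (-1 : ℝ) 1, f y * Real.exp (s * y) = 0) (g : C(Icc (-1 : ℝ) 1, ℝ)) :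
    (∫ y in Ioo (-1 : ℝ) 1, (Real.exp y * IccExtend h11 g y) * f y) = 0 := by
  by_contra hne
  set M : ℝ := Real.exp 1 * ∫ y in Ioo (-1 : ℝ) 1, |f y| with hM_def
  have hM0 : 0 ≤ M := mul_nonneg (Real.exp_pos 1).le (integral_nonneg fun _ => abs_nonneg _)
  have hL : 0 < |(∫ y in Ioo (-1 : ℝ) 1, (Real.exp y * IccExtend h11 g y) * f y)| := abs_pos.mpr hne
  obtain ⟨⟨g', hg'⟩, hlt⟩ := ContinuousMap.exists_mem_subalgebra_near_continuousMap_of_separatesPoints (Algebra.adjoin ℝ {g : C(Icc (-1 : ℝ) 1, ℝ) | ∃ s : ℝ, 0 ≤ s ∧ g = (⟨fun x : Icc (-1 : ℝ) 1 => Real.exp (s * (x : ℝ)), by fun_prop⟩ : C(Icc (-1 : ℝ) 1, ℝ))})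
    expAlg_separatesPoints g (|(∫ y in Ioo (-1 : ℝ) 1, (Real.exp y * IccExtend h11 g y) * f y)| / (M + 1)) (by positivity)
  have h1 : (∫ y in Ioo (-1 : ℝ) 1, (Real.exp y * IccExtend h11 g y) * f y) = -((∫ y in Ioo (-1 : ℝ) 1, (Real.exp y * IccExtend h11 (g' - g) y) * f y)) := by
    rw [lam_sub hfi, lam_eq_zero_of_mem_expAlg hfi h0 hg']; ring
  have h2 : |(∫ y in Ioo (-1 : ℝ) 1, (Real.exp y * IccExtend h11 g y) * f y)| ≤ M * ‖g' - g‖ := by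
    rw [h1, abs_neg]
    calc |(∫ y in Ioo (-1 : ℝ) 1, (Real.exp y * IccExtend h11 (g' - g) y) * f y)| ≤ Real.exp 1 * ‖g' - g‖ * ∫ y in Ioo (-1 : ℝ) 1, |f y| := abs_lam_le hfi _
      _ = M * ‖g' - g‖ := by rw [hM_def]; ring
  have h3 : M * ‖g' - g‖ ≤ M * (|(∫ y in Ioo (-1 : ℝ) 1, (Real.exp y * IccExtend h11 g y) * f y)| / (M + 1)) := mul_le_mul_of_nonneg_left hlt.le hM0
  have h4 : M * (|(∫ y in Ioo (-1 : ℝ) 1, (Real.exp y * IccExtend h11 g y) * f y)| / (M + 1)) < |(∫ y in Ioo (-1 : ℝ) 1, (Real.exp y * IccExtend h11 g y) * f y)| := by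
    rw [mul_div_assoc', div_lt_iff₀ (by positivity)]
    nlinarith
  linarith

/-- **P1b PROVED** (ζ-free). -/
theorem windowSymbolNonvanishing : (∀ f : ℝ → ℝ, MemLp f 2 (volume.restrict (Ioo (-1) 1)) →
    ¬ (f =ᵐ[volume.restrict (Ioo (-1) 1)] 0) → ∃ z : ℂ, 0 < z.im ∧ (∫ u : ℝ, (((Ioo (-1 : ℝ) 1).indicator (fun u => f (-u)) u : ℝ) : ℂ) * Complex.exp (I * z * (u : ℂ))) ≠ 0) := by
  intro f hf hf0
  by_contra hcon
  push Not at hcon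
  apply hf0
  haveI : IsFiniteMeasure (volume.restrict (Ioo (-1 : ℝ) 1)) := by
    refine ⟨?_⟩
    rw [Measure.restrict_apply_univ, Real.volume_Ioo]
    exact ENNReal.ofReal_lt_top
  have hfi : Integrable f (volume.restrict (Ioo (-1 : ℝ) 1)) := hf.integrable one_le_two
  have h0 : ∀ s : ℝ, 0 < s → ∫ y in Ioo (-1 : ℝ) 1, f y * Real.exp (s * y) = 0 :=
    fun s hs => expMoment_eq_zero_of_windowSymbol hcon hs
  have hLam : ∀ g : C(Icc (-1 : ℝ) 1, ℝ), (∫ y in Ioo (-1 : ℝ) 1, (Real.exp y * IccExtend h11 g y) * f y) = 0 := lam_eq_zero hfi h0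
  have key : ∀ᵐ x ∂(volume : Measure ℝ), x ∈ Ioo (-1 : ℝ) 1 → f x = 0 := by
    refine isOpen_Ioo.ae_eq_zero_of_integral_contDiff_smul_eq_zero
      (IntegrableOn.locallyIntegrableOn hfi) ?_
    intro φ hφ _ hφS
    have hφc : Continuous φ := hφ.continuous
    let ψ : C(Icc (-1 : ℝ) 1, ℝ) := ⟨fun x => φ (x : ℝ) * Real.exp (-(x : ℝ)), by fun_prop⟩
    have h := hLam ψ
    rw [← setIntegral_eq_integral_of_forall_compl_eq_zero (s := Ioo (-1 : ℝ) 1) ?_]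
    · rw [← h]
      refine setIntegral_congr_fun measurableSet_Ioo fun y hy => ?_
      have hyI : y ∈ Icc (-1 : ℝ) 1 := Ioo_subset_Icc_self hy
      simp only [Set.IccExtend_of_mem h11 _ hyI, ψ, ContinuousMap.coe_mk, smul_eq_mul]
      rw [Real.exp_neg]
      field_simp
    · intro x hx
      have hx' : x ∉ tsupport φ := fun h' => hx (hφS h')
      simp [image_eq_zero_of_notMem_tsupport hx']
  rw [EventuallyEq, ae_restrict_iff' measurableSet_Ioo]
  filter_upwards [key] with x hx hxS
  simpa using hx hxS

/-- **P1 PROVED** (RH-FREE): for `θ > 10`, EVERY nonzero `f ∈ L²(−1,1)` is an RH-detector —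
`𝖪_θ[1] f ∈ L²(ℝ) ⟹ RH`. (The tree had this for `f = 1_{(0,1)}` only: `SuzukiWindowsDoor.rh_of_window_memLp`.) -/
theorem everyWitnessDetectsRH {θ : ℝ} (hθ : 10 < θ) : (∀ f : ℝ → ℝ, MemLp f 2 (volume.restrict (Ioo (-1) 1)) →
    ¬ (f =ᵐ[volume.restrict (Ioo (-1) 1)] 0) →
    MemLp (fun x : ℝ => ∫ y in Ioo (-1:ℝ) 1, limKernel θ (x + y) * f y) 2 volume → _root_.RiemannHypothesis) :=
  everyWitnessDetectsRH_of hθ (weightedLaplaceFactorisation (by linarith)) windowSymbolNonvanishing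

/-- **P1 unfolded**: any single nonzero square-integrable window function whose `𝖪_θ[1]`-image is square-integrable
proves RH (θ > 10). RH-FREE, sorry-free. -/
theorem rh_of_windowWitness {θ : ℝ} (hθ : 10 < θ) (f : ℝ → ℝ)
    (hf : MemLp f 2 (volume.restrict (Ioo (-1 : ℝ) 1))) (hf0 : ¬ f =ᵐ[volume.restrict (Ioo (-1 : ℝ) 1)] 0)
    (hK : MemLp ((fun x : ℝ => ∫ y in Ioo (-1:ℝ) 1, limKernel θ (x + y) * f y)) 2 volume) : _root_.RiemannHypothesis :=
  everyWitnessDetectsRH hθ f hf hf0 hK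

end Summit.RiemannHypothesis.RiemannHypothesis.Theorems.SuzukiDoorEveryWitness

end
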